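import Summits.AtomisticToContinuum.Crystallization.Theorems.LayeredLawsSelectHcp.Negative.DiracLaws

/-!
# Negative knowledge for crux `LayeredLawsSelectHcp` (stmt-AtomisticToContinuum-9226), VII:
# the Palm law of ANY periodic configuration of `ℝ³` satisfies H1 and H2

Standing crux disprover (cdisprove, gen 1), `--supports stmt-AtomisticToContinuum-9226`. For a
`PeriodicConfiguration 3` (`Q = F + G`, Blanc–Lewin's multi-lattices): the point set is countable
(`countable_points`, from the finite `ℤ`-basis `Blocks.zBasis`), `motifLatticeEquiv : F × G ≃ Q.points`
(`(x, ℓ) ↦ x + ℓ`, a bijection because motif points are pairwise inequivalent mod `G`), the views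
`view Q x = Q.points − x` and their counting measures, `map_count_restrict_image` (a measurable bijection
pushes `count|S` to `count|e(S)`), `lintegral_viewMeasure` (`∫⁻ f d(count|(Q − x)) = ∑_{p ∈ Q} f(p − x)`), and
**the Palm law `palmLaw Q = (#F)⁻¹ ∑_{x ∈ F} δ_{count|(Q − x)}`** (root at a uniformly chosen motif point):
a probability law (`ae_palmLaw` / `of_ae_palmLaw` / `lintegral_palmLaw` / `integral_palmLaw` read it atom by
atom), ROOTED and `δ`-separated when `Q.points` is (`rooted_palmLaw`, H1 of the crux), and
**POINT-STATIONARY** (`pointStationary_palmLaw`: the crux's Mecke identity H2 verbatim — both sides are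
`(#F)⁻¹ ∑_{x ∈ F} ∑_{p ∈ Q}(…)`; on the right `θ_{−(p−x)}(Q − x) = Q − p = Q − x'` for `p = x' + ℓ`
(`map_sub_viewMeasure`, `view_add_period`), and re-indexing `p ↔ (x', ℓ)`, `ℓ ↦ −ℓ` gives the left side).
This is the first NON-lattice family certified against H2 (for a two-point motif such as hcp the `−y`
convention of H2 matters; lattice laws, part I, cannot detect it). Part VIII adds `E_{P_Q}[h] = e(Q)` and what
the crux therefore asserts about periodic configurations. All `[folklore]`.
-/

noncomputable section

namespace Summit.AtomisticToContinuum.Crystallization.Theorems.LayeredLawsSelectHcp.Negative.PeriodicPalmLaw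

open MeasureTheory Set
open Literature.MathematicalPhysics.StatisticalMechanics Literature.Geometry.DiscreteGeometry
open Summit.AtomisticToContinuum.Crystallization.Theses.PalmUnimodularRigidity (LayeredLawsSelectHcp)
open Summit.AtomisticToContinuum.Crystallization.Theorems.ChargedEnergyGapNegative
  (eStar eStar_le bddBelow_energyPerParticle_lennardJones)
open Summit.AtomisticToContinuum.Crystallization.Theorems.LayeredLawsSelectHcp.Negative.DiracLaws
open Summit.AtomisticToContinuum.Crystallization.Theorems.ChargedEnergyGapNegative.Blocks (zBasis)

/-- Euclidean `3`-space. [folklore] -/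
local notation "E3" => EuclideanSpace ℝ (Fin 3)

variable (Q : PeriodicConfiguration 3)

/-! ## §1 Countability and the motif × lattice parametrisation of the point set -/

/-- The lattice of periods is countable (it has a finite `ℤ`-basis). [folklore] -/
theorem countable_lattice : (Q.lattice : Set E3).Countable := by
  have : Countable Q.lattice :=
    Countable.of_equiv (Fin 3 → ℤ) (zBasis Q).equivFun.toEquiv.symm
  exact Set.countable_coe_iff.1 this

/-- The point set is the finite union of the shifted lattices. [folklore] -/
theorem points_eq_biUnion :
    Q.points = ⋃ x ∈ Q.motif, (fun g : E3 => x + g) '' (Q.lattice : Set E3) := by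
  ext z
  simp only [PeriodicConfiguration.points, Set.mem_setOf_eq, Set.mem_iUnion, Set.mem_image,
    SetLike.mem_coe, exists_prop]
  constructor
  · rintro ⟨y, hy, g, hg, rfl⟩
    exact ⟨y, hy, g, hg, rfl⟩
  · rintro ⟨y, hy, g, hg, rfl⟩
    exact ⟨y, hy, g, hg, rfl⟩

/-- The point set of a periodic configuration is countable. [folklore] -/
theorem countable_points : Q.points.Countable := by
  rw [points_eq_biUnion]
  exact Set.Countable.biUnion Q.motif.countable_toSet fun x _ => (countable_lattice Q).image _

/-- **`F × G ≃ F + G`**: `(x, ℓ) ↦ x + ℓ` is a bijection from motif × lattice onto the point set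
(motif points are pairwise inequivalent modulo the lattice). [folklore] -/
def motifLatticeEquiv : ↥Q.motif × ↥Q.lattice ≃ ↥Q.points :=
  Equiv.ofBijective
    (fun p => ⟨(p.1 : E3) + (p.2 : E3), Q.add_mem_points (Q.mem_points_of_mem_motif p.1.2) p.2.2⟩)
    (by
      constructor
      · rintro ⟨x, l⟩ ⟨x', l'⟩ h
        have h1 : (x : E3) + (l : E3) = (x' : E3) + (l' : E3) := congrArg Subtype.val h
        have hsub : (x : E3) - (x' : E3) = (l' : E3) - (l : E3) := by
          rw [sub_eq_sub_iff_add_eq_add, h1, add_comm]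
        have hx : (x : E3) = (x' : E3) := by
          refine Q.eq_of_sub_mem x x.2 x' x'.2 ?_
          rw [hsub]
          exact Q.lattice.sub_mem l'.2 l.2
        have hl : (l : E3) = (l' : E3) := by
          rw [hx] at h1
          exact add_left_cancel h1
        exact Prod.ext (Subtype.ext hx) (Subtype.ext hl)
      · rintro ⟨z, hz⟩
        obtain ⟨y, hy, g, hg, rfl⟩ := hz
        exact ⟨(⟨y, hy⟩, ⟨g, hg⟩), rfl⟩)

/-- The bijection is `(x, ℓ) ↦ x + ℓ`. [folklore] -/
@[simp] theorem motifLatticeEquiv_apply_coe (p : ↥Q.motif × ↥Q.lattice) :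
    ((motifLatticeEquiv Q p : ↥Q.points) : E3) = (p.1 : E3) + (p.2 : E3) := rfl

/-- Translating the point set by a period leaves it invariant. [folklore] -/
theorem image_sub_period {l : E3} (hl : l ∈ Q.lattice) :
    (fun p : E3 => p - l) '' Q.points = Q.points := by
  ext z
  simp only [Set.mem_image]
  constructor
  · rintro ⟨p, hp, rfl⟩
    rw [sub_eq_add_neg]
    exact Q.add_mem_points hp (Q.lattice.neg_mem hl)
  · intro hz
    exact ⟨z + l, Q.add_mem_points hz hl, add_sub_cancel_right z l⟩

/-! ## §2 Views from the points; the Palm law -/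

/-- The configuration seen from `x`: `Q.points − x`. [folklore] -/
def view (x : E3) : Set E3 := (fun p : E3 => p - x) '' Q.points

/-- … as a counting measure (a rooted configuration when `x ∈ Q.points`). [folklore] -/
def viewMeasure (x : E3) : Measure E3 := (Measure.count : Measure E3).restrict (view Q x)

/-- Views are countable. [folklore] -/
theorem countable_view (x : E3) : (view Q x).Countable := (countable_points Q).image _

/-- The root is a point of the view from a point. [folklore] -/
theorem zero_mem_view {x : E3} (hx : x ∈ Q.points) : (0 : E3) ∈ view Q x := ⟨x, hx, sub_self x⟩

/-- Views inherit the separation of the point set. [folklore] -/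
theorem view_separated {δ : ℝ} (hsep : ∀ p ∈ Q.points, ∀ q ∈ Q.points, p ≠ q → δ ≤ dist p q)
    (x : E3) : ∀ p ∈ view Q x, ∀ q ∈ view Q x, p ≠ q → δ ≤ dist p q := by
  rintro _ ⟨p, hp, rfl⟩ _ ⟨q, hq, rfl⟩ hne
  rw [dist_sub_right]
  exact hsep p hp q hq fun h => hne (by rw [h])

/-- Views from lattice-equivalent points coincide: `Q − (x + ℓ) = Q − x`. [folklore] -/
theorem view_add_period (x : E3) {l : E3} (hl : l ∈ Q.lattice) : view Q (x + l) = view Q x := by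
  unfold view
  conv_rhs => rw [← image_sub_period Q hl]
  rw [Set.image_image]
  congr 1
  funext p
  abel

/-- A measurable bijection of `ℝ³` pushes `count|S` to `count|e(S)` (`S` countable). [folklore] -/
theorem map_count_restrict_image (e : E3 ≃ᵐ E3) {S : Set E3} (hS : S.Countable) :
    Measure.map e ((Measure.count : Measure E3).restrict S) =
      (Measure.count : Measure E3).restrict (e '' S) := by
  have hSm : MeasurableSet S := hS.measurableSet
  have hS' : (e '' S).Countable := hS.image _
  ext t ht
  rw [MeasurableEquiv.map_apply, Measure.restrict_apply (e.measurable ht), Measure.restrict_apply ht]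
  have h1 : e ⁻¹' t ∩ S = e ⁻¹' (t ∩ e '' S) := by
    rw [Set.preimage_inter, e.injective.preimage_image]
  have hu : MeasurableSet (t ∩ e '' S) := ht.inter hS'.measurableSet
  rw [h1, Measure.count_apply (e.measurable hu), Measure.count_apply hu,
    ← MeasurableEquiv.image_symm, e.symm.injective.encard_image]

/-- Shifting the view from `x` by `−y` gives the view from `x + y`. [folklore] -/
theorem map_sub_viewMeasure (x y : E3) :
    Measure.map (fun z => z - y) (viewMeasure Q x) = viewMeasure Q (x + y) := by
  have : (fun z : E3 => z - y) = ⇑(MeasurableEquiv.subRight y) := rfl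
  unfold viewMeasure
  rw [this, map_count_restrict_image _ (countable_view Q x)]
  congr 1
  change (fun z : E3 => z - y) '' view Q x = view Q (x + y)
  unfold view
  rw [Set.image_image]
  congr 1
  funext p
  abel

/-- The counting measure of a countable set is the sum of the unit Dirac masses at its points.
[folklore] -/
theorem count_restrict_eq_sum_dirac {S : Set E3} (hS : S.Countable) :
    (Measure.count : Measure E3).restrict S =
      Measure.sum fun i : S => (1 : ENNReal) • Measure.dirac (i : E3) := by
  have hSm : MeasurableSet S := hS.measurableSet
  ext t ht
  rw [Measure.restrict_apply ht, Measure.sum_apply _ ht, Measure.count, Measure.sum_apply _ (ht.inter hSm)]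
  simp_rw [Measure.smul_apply, one_smul, Measure.dirac_apply' _ (ht.inter hSm), Measure.dirac_apply' _ ht]
  rw [tsum_subtype S (t.indicator (1 : E3 → ENNReal)), Set.indicator_indicator, Set.inter_comm]

/-- `∫⁻ f d(count|S) = ∑_{p ∈ S} f p` for countable `S`. [folklore] -/
theorem lintegral_count_restrict_tsum {S : Set E3} (hS : S.Countable) (f : E3 → ENNReal) :
    ∫⁻ y, f y ∂((Measure.count : Measure E3).restrict S) = ∑' p : S, f p := by
  rw [count_restrict_eq_sum_dirac hS, lintegral_sum_measure]
  congr 1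
  funext p
  rw [lintegral_smul_measure, lintegral_dirac, one_smul]

/-- **Integration against a view is a sum over the point set.** [folklore] -/
theorem lintegral_viewMeasure (x : E3) (f : E3 → ENNReal) :
    ∫⁻ y, f y ∂(viewMeasure Q x) = ∑' p : ↥Q.points, f ((p : E3) - x) := by
  have : (fun z : E3 => z - x) = ⇑(MeasurableEquiv.subRight x) := rfl
  unfold viewMeasure view
  rw [this, ← map_count_restrict_image _ (countable_points Q), lintegral_map_equiv,
    lintegral_count_restrict_tsum (countable_points Q)]
  rfl

/-- **The Palm law of a periodic configuration**: root it at a uniformly chosen motif point,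
`P_Q = (#F)⁻¹ ∑_{x ∈ F} δ_{count|(Q − x)}`. [folklore] -/
def palmLaw : Measure (Measure E3) :=
  ((Q.motif.card : ENNReal))⁻¹ • ∑ x ∈ Q.motif, Measure.dirac (viewMeasure Q x)

/-- The motif is non-empty, so `#F ≠ 0`. [folklore] -/
theorem card_ne_zero : (Q.motif.card : ENNReal) ≠ 0 := by
  exact_mod_cast Q.motif_nonempty.card_pos.ne'

/-- The Palm law is a probability law. [folklore] -/
instance : IsProbabilityMeasure (palmLaw Q) := by
  refine ⟨?_⟩
  simp only [palmLaw, Measure.smul_apply, Measure.coe_finsetSum, Finset.sum_apply, measure_univ,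
    Finset.sum_const, nsmul_eq_mul, mul_one, smul_eq_mul]
  exact ENNReal.inv_mul_cancel (card_ne_zero Q) (ENNReal.natCast_ne_top _)

/-- The atoms of the Palm law are measurable singletons. [folklore] -/
theorem measurableSet_viewAtom (x : E3) :
    MeasurableSet ({viewMeasure Q x} : Set (Measure E3)) :=
  measurableSet_singleton_count_restrict (countable_view Q x)

/-- A.s. statements under the Palm law: check them at each motif view. [folklore] -/
theorem ae_palmLaw {p : Measure E3 → Prop} (h : ∀ x ∈ Q.motif, p (viewMeasure Q x)) :
    ∀ᵐ μ ∂(palmLaw Q), p μ := by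
  unfold palmLaw
  refine Measure.ae_smul_measure ?_ _
  rw [ae_iff, Measure.coe_finsetSum, Finset.sum_apply]
  refine Finset.sum_eq_zero fun x hx => ?_
  have := ae_dirac_of_mem (measurableSet_viewAtom Q x) (h x hx)
  rwa [ae_iff] at this

/-- Conversely an a.s. statement under the Palm law holds at each motif view. [folklore] -/
theorem of_ae_palmLaw {p : Measure E3 → Prop} (h : ∀ᵐ μ ∂(palmLaw Q), p μ) :
    ∀ x ∈ Q.motif, p (viewMeasure Q x) := by
  intro x hx
  unfold palmLaw at h
  rw [ae_iff, Measure.smul_apply, smul_eq_mul, mul_eq_zero] at h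
  rcases h with h | h
  · exact absurd h (ENNReal.inv_ne_zero.2 (ENNReal.natCast_ne_top _))
  · rw [Measure.coe_finsetSum, Finset.sum_apply] at h
    have hx0 := Finset.sum_eq_zero_iff.1 h x hx
    by_contra hp
    have : Measure.dirac (viewMeasure Q x) {μ | ¬ p μ} = 1 := Measure.dirac_apply_of_mem hp
    rw [hx0] at this
    exact zero_ne_one this

/-- `∫⁻ F dP_Q = (#F)⁻¹ ∑_{x ∈ F} F(count|(Q − x))`. [folklore] -/
theorem lintegral_palmLaw (F : Measure E3 → ENNReal) :
    ∫⁻ μ, F μ ∂(palmLaw Q) = ((Q.motif.card : ENNReal))⁻¹ * ∑ x ∈ Q.motif, F (viewMeasure Q x) := by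
  unfold palmLaw
  rw [lintegral_smul_measure, lintegral_finsetSum_measure]
  congr 1
  exact Finset.sum_congr rfl fun x _ => lintegral_dirac_of_mem (measurableSet_viewAtom Q x) F

/-- `∫ F dP_Q = (#F)⁻¹ ∑_{x ∈ F} F(count|(Q − x))` (Bochner; any `F`). [folklore] -/
theorem integral_palmLaw (F : Measure E3 → ℝ) :
    ∫ μ, F μ ∂(palmLaw Q) = ((Q.motif.card : ℝ))⁻¹ * ∑ x ∈ Q.motif, F (viewMeasure Q x) := by
  unfold palmLaw
  have hint : ∀ x ∈ Q.motif, Integrable F (Measure.dirac (viewMeasure Q x)) := fun x _ =>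
    (integrable_const (F (viewMeasure Q x))).congr
      (ae_dirac_of_mem (measurableSet_viewAtom Q x) (p := fun μ => F (viewMeasure Q x) = F μ) rfl)
  rw [integral_smul_measure, integral_finsetSum_measure hint]
  simp only [integral_dirac_of_mem (measurableSet_viewAtom Q _), ENNReal.toReal_inv,
    ENNReal.toReal_natCast, smul_eq_mul]

/-! ## §3 The Palm law of a periodic configuration satisfies H1 and H2 -/

/-- **H1**: rooted and `δ`-separated whenever `Q.points` is `δ`-separated. [folklore] -/
theorem rooted_palmLaw {δ : ℝ} (hsep : ∀ p ∈ Q.points, ∀ q ∈ Q.points, p ≠ q → δ ≤ dist p q) :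
    Rooted δ (palmLaw Q) :=
  ae_palmLaw Q fun x hx =>
    ⟨view Q x, zero_mem_view Q (Q.mem_points_of_mem_motif hx), view_separated Q hsep x, rfl⟩

/-- **H2: the Palm law of a periodic configuration is point-stationary** (Mecke identity). Both sides
are `(#F)⁻¹ ∑_{x ∈ F} ∑_{p ∈ Q} (…)`; on the right, `θ_{-(p-x)}(Q − x) = Q − p = Q − x'` with
`p = x' + ℓ`, and re-indexing `p ↔ (x', ℓ) ↔ (x, ℓ) ↦ x − ℓ` turns it into the left side. [folklore] -/
theorem pointStationary_palmLaw : PointStationary (palmLaw Q) := by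
  intro g _
  rw [lintegral_palmLaw, lintegral_palmLaw]
  congr 1
  simp_rw [lintegral_viewMeasure]
  set e := motifLatticeEquiv Q with he
  -- the shifted view from `x` by `p - x` is the view from `p`, i.e. from its motif representative
  have hview : ∀ (x : E3) (p : ↥Q.points),
      Measure.map (fun z => z - ((p : E3) - x)) (viewMeasure Q x) = viewMeasure Q ((e.symm p).1 : E3) := by
    intro x p
    rw [map_sub_viewMeasure, add_sub_cancel]
    have hp : (p : E3) = ((e.symm p).1 : E3) + ((e.symm p).2 : E3) := by
      conv_lhs => rw [← e.apply_symm_apply p]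
      rfl
    unfold viewMeasure
    rw [hp, view_add_period Q _ ((e.symm p).2).2]
  simp_rw [hview]
  -- rewrite both sides as sums over `F × G`
  rw [← Finset.sum_coe_sort Q.motif, ← Finset.sum_coe_sort Q.motif]
  have hL : ∀ x : ↥Q.motif, ∑' p : ↥Q.points, g (viewMeasure Q x) ((p : E3) - x) =
      ∑' q : ↥Q.motif × ↥Q.lattice, g (viewMeasure Q x) ((q.1 : E3) + (q.2 : E3) - x) := fun x => by
    rw [← Equiv.tsum_eq e]
    rfl
  have hR : ∀ x : ↥Q.motif, ∑' p : ↥Q.points, g (viewMeasure Q ((e.symm p).1 : E3)) (-((p : E3) - x)) =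
      ∑' q : ↥Q.motif × ↥Q.lattice, g (viewMeasure Q (q.1 : E3)) ((x : E3) - q.1 - q.2) := fun x => by
    rw [← Equiv.tsum_eq e]
    refine tsum_congr fun q => ?_
    rw [Equiv.symm_apply_apply]
    have hq : ((e q : ↥Q.points) : E3) = (q.1 : E3) + (q.2 : E3) := rfl
    rw [hq]
    congr 1
    abel
  have eL : ∑ x : ↥Q.motif, ∑' p : ↥Q.points, g (viewMeasure Q x) ((p : E3) - x) =
      ∑ x : ↥Q.motif, ∑ x' : ↥Q.motif, ∑' l : ↥Q.lattice,
        g (viewMeasure Q x) ((x' : E3) + (l : E3) - x) := by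
    refine Finset.sum_congr rfl fun x _ => ?_
    rw [hL x, ENNReal.tsum_prod', tsum_fintype]
  have eR : ∑ x : ↥Q.motif, ∑' p : ↥Q.points, g (viewMeasure Q ((e.symm p).1 : E3)) (-((p : E3) - x)) =
      ∑ x : ↥Q.motif, ∑ x' : ↥Q.motif, ∑' l : ↥Q.lattice,
        g (viewMeasure Q (x' : E3)) ((x : E3) - x' - l) := by
    refine Finset.sum_congr rfl fun x _ => ?_
    rw [hR x, ENNReal.tsum_prod', tsum_fintype]
  rw [eL, eR, Finset.sum_comm]
  refine Finset.sum_congr rfl fun x' _ => ?_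
  -- for fixed `x'`: `∑_x ∑'_ℓ g ν_{x'} (x + ℓ - x') = ∑_x ∑'_ℓ g ν_{x'} (x - x' - ℓ)` by `ℓ ↦ -ℓ`
  refine Finset.sum_congr rfl fun x _ => ?_
  rw [← Equiv.tsum_eq (Equiv.neg ↥Q.lattice)]
  refine tsum_congr fun l => ?_
  have hl : ((Equiv.neg ↥Q.lattice l : ↥Q.lattice) : E3) = -(l : E3) := rfl
  rw [hl]
  congr 1
  abel

end Summit.AtomisticToContinuum.Crystallization.Theorems.LayeredLawsSelectHcp.Negative.PeriodicPalmLaw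

end
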